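import Literature.AlgebraicGeometry.Resolution.GeneralizedStabilityLemma55VT
import Literature.AlgebraicGeometry.Resolution.HenselizationDefectless
import Literature.AlgebraicGeometry.Resolution.HenselizationHenselian
import Literature.AlgebraicGeometry.Resolution.HenselizationImmediateProofs
import HarnessLib

/-!
# Generalized stability for `K(t)`, value-transcendental case: reduction to Ostrowski's lemma and the italicized statement of §5

Topic: `Literature/AlgebraicGeometry/Resolution` (valued function fields). Bookkeeping file of
the decomposition of `Kuhlmann2010StabilityRankOneValueTranscendental`
(`GeneralizedStabilityRankOne.lean` = F.-V. Kuhlmann, *Elimination of ramification I: The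
generalized stability theorem*, Trans. AMS 362 (2010) 5697–5727 = arXiv:1003.5678, §5,
Lemma 5.4, (R4) for `F = K(t)` of rank one over an algebraically closed `K` with a
value-transcendental generator). `GeneralizedStabilityLemma55VT.lean` proves it from FIVE named
facts (`Kuhlmann2010StabilityRankOneValueTranscendental.of_facts'`); three of them have since
been DISCHARGED in the tree:

* Thm. 2.14 — `Kuhlmann2010DefectlessIffHenselization_holds` (`HenselizationDefectless.lean`),
* "the henselization is henselian" — `Kuhlmann2010HenselizationIsHenselian_holds`
  (`HenselizationHenselian.lean`),
* Lemma 2.2, "the henselization is immediate" — `Kuhlmann2010HenselizationImmediate_holds`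
  (`HenselizationImmediateProofs.lean`).

Feeding them in leaves (R4), value-transcendental case, resting on exactly TWO named facts of
`GeneralizedStabilityHenselizedRational.lean`: the Lemma of Ostrowski
(`Kuhlmann2010OstrowskiLemma`, §2.3 (9)) and the italicized statement of §5 for `K(x)^h`
(`Kuhlmann2010HenselizedRationalImmediateExt`, p. 19: "henselized inertially generated function
fields of rank 1 and of transcendence degree 1 with a valuation-transcendental generator over an
algebraically closed ground field do not admit proper immediate algebraic extensions").

## Content (PROVED)

* `Kuhlmann2010Lemma55ValueTranscendental.of_immediateExt'` — Lemma 5.5 (Case I) from the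
  italicized statement alone.
* `Kuhlmann2010StabilityHenselizedRationalValueTranscendental.of_ostrowski_of_immediateExt` —
  `K(x)^h` (rank one, `x` value-transcendental, `K` algebraically closed) is a defectless field,
  from Ostrowski's lemma and the italicized statement.
* `Kuhlmann2010StabilityRankOneValueTranscendental.of_ostrowski_of_immediateExt` — (R4) for
  `K(t)`, value-transcendental case, from the same two facts.

## Sources

* F.-V. Kuhlmann, *Elimination of ramification I: The generalized stability theorem*, Trans.
  Amer. Math. Soc. 362 (2010) 5697–5727 = arXiv:1003.5678: §2.3 ((9), Thm. 2.14), Lemma 2.2,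
  Lemma 2.3, §5 (Lemma 5.4 (R4), proof of (R4) pp. 18–20, Lemma 5.5).
-/

noncomputable section

namespace Literature.AlgebraicGeometry.Resolution

universe u

/-- **Kuhlmann 2010, Lemma 5.5 (Case I) from the italicized statement of §5 alone** (with
Lemma 2.2 and "the henselization is henselian" now proved in the tree).
[cite: Kuhlmann2010, Lemma 5.5 and Lemma 2.26] -/
theorem Kuhlmann2010Lemma55ValueTranscendental.of_immediateExt'
    (hM : Kuhlmann2010HenselizedRationalImmediateExt.{u}) :
    Kuhlmann2010Lemma55ValueTranscendental.{u} :=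
  Kuhlmann2010Lemma55ValueTranscendental.of_immediateExt
    Kuhlmann2010HenselizationIsHenselian_holds Kuhlmann2010HenselizationImmediate_holds hM

/-- **`K(x)^h` of rank one with a value-transcendental generator over an algebraically closed `K`
is a defectless field, from the Lemma of Ostrowski and the italicized statement of §5** (the
assembly `…of_parts` of `GeneralizedStabilityRankOneVTProofs.lean` with "the henselization is
henselian" and Lemma 5.5 supplied by the tree). [cite: Kuhlmann2010, Section 5, proof of Thm. 1.1 (pp. 18–20)] -/
theorem Kuhlmann2010StabilityHenselizedRationalValueTranscendental.of_ostrowski_of_immediateExt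
    (hO : Kuhlmann2010OstrowskiLemma.{u}) (hM : Kuhlmann2010HenselizedRationalImmediateExt.{u}) :
    Kuhlmann2010StabilityHenselizedRationalValueTranscendental.{u} :=
  Kuhlmann2010StabilityHenselizedRationalValueTranscendental.of_parts
    Kuhlmann2010HenselizationIsHenselian_holds hO hM
    (Kuhlmann2010Lemma55ValueTranscendental.of_immediateExt' hM)

/-- **Kuhlmann 2010, (R4) for `F = K(t)` of rank one with a value-transcendental generator over
an algebraically closed `K`, from the Lemma of Ostrowski and the italicized statement of §5**
(Thm. 2.14, "the henselization is henselian" and Lemma 2.2 being proved in the tree): the trust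
base of `Kuhlmann2010StabilityRankOneValueTranscendental` is
{`Kuhlmann2010OstrowskiLemma`, `Kuhlmann2010HenselizedRationalImmediateExt`}.
[cite: Kuhlmann2010, Section 5, Lemma 5.4 (R4) and proof of (R4) (pp. 18–20)] -/
theorem Kuhlmann2010StabilityRankOneValueTranscendental.of_ostrowski_of_immediateExt
    (hO : Kuhlmann2010OstrowskiLemma.{u}) (hM : Kuhlmann2010HenselizedRationalImmediateExt.{u}) :
    Kuhlmann2010StabilityRankOneValueTranscendental.{u} :=
  Kuhlmann2010StabilityRankOneValueTranscendental.of_facts'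
    Kuhlmann2010DefectlessIffHenselization_holds Kuhlmann2010HenselizationIsHenselian_holds
    Kuhlmann2010HenselizationImmediate_holds hO hM

end Literature.AlgebraicGeometry.Resolution
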